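import Literature.NumberTheory.LFunctions.SchoenfeldPsiTable
import Literature.NumberTheory.LFunctions.PrimeNumberTheoremErrorRHExplicitThetaWindow
import HarnessLib

/-!
# RH-CONDITIONAL (the window itself is RH-FREE) — Lee–Nosal 2026, Theorem 1.2 (`ψ`): the window `101 ≤ x < 353` by kernel computation, hence `|ψ(x) − x| ≤ √x log x (log x − log log x)/(8π)` for ALL `x ≥ 101` under RH modulo Büthe («nothing here bears on the truth of RH»)

Topic `Literature/NumberTheory/LFunctions` (RH literature-typing tranche 1, gen 10). Labels: the
finite-range certificate `abs_psi_sub_le_window` is **RH-FREE** (a statement about the prime powers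
below `353`); the assembled theorem `LeeNosal2026_psi_of_buthe` is **RH-CONDITIONAL**. No named
facts; the `def`s are computable checker functions and two constants. Nothing here bears on the
truth of RH.

`PrimeNumberTheoremErrorRHExplicitProofs.lean` proves Lee–Nosal's Theorem 1.2 (J. Number Theory 283
(2026), Thm. 1.2: under RH `|ψ(x) − x| ≤ 𝓑(x) = √x log x (log x − log log x)/(8π)` for `x ≥ 101`) for
`x ≥ 10¹⁰` by the explicit formula and for `x ≥ 350` modulo Büthe's Theorem 2
(`LeeNosalThm12.psi_of_buthe`). The printed threshold `101` is where the inequality starts to hold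
(it fails on `[97, 101)`); the window `101 ≤ x < 350` is a finite statement about `ψ`, settled here
by a kernel computation:

* `abs_psi_sub_le_window`: `|ψ(x) − x| ≤ 𝓑(x)` for all real `101 ≤ x < 353`, unconditionally;
* **`LeeNosal2026_psi_of_buthe (hB : Buthe2018_thm2_psi) (hRH : RiemannHypothesis) :
  ∀ x ≥ 101, |ψ(x) − x| ≤ 𝓑(x)`** — the `ψ`-line of `LeeNosal2026_thm12` on its full printed range,
  modulo Büthe's unconditional computer-assisted bound `|x − ψ(x)| ≤ 0.94√x` (`11 < x ≤ 10¹⁹`).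

Together with `PrimeNumberTheoremErrorRHExplicitThetaWindow.lean` (the `θ`-line for `x ≥ 2657`):

* **`LeeNosal2026_thm12_of_buthe : Buthe2018_thm2_psi → Buthe2018_thm2_theta → LeeNosal2026_thm12`**
  — the named fact `LeeNosal2026_thm12` (both lines, printed ranges) is a theorem modulo Büthe's
  two unconditional numerical bounds below `10¹⁹` (which are exactly the inputs the source itself
  uses there, loc. cit. §3.3).

METHOD. The integer-by-integer `ψ`-chain of `SchoenfeldPsiTable.lean` (`PsiChain.update`: prime-power
classification `PsiChain.classify`, enclosures `plo ≤ 2⁸⁰ψ(n) ≤ phi`; its soundness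
`PsiChain.update_sound` is reused verbatim) with Schoenfeld's comparison replaced by `chkOK`/`chkLNn`:
on the cell `[n, n+1)`, `n ≥ 101`, with a fresh enclosure `l ≤ 2⁸⁰ log n` (`ChainCheck.logN n`) and
the piecewise constant `μ = Mof n/2⁸⁰ ≥ log log n` (`1.6998` for `n ≤ 238`, `1.7689` for
`239 ≤ n ≤ 352`; `loglog_le_Mof`, kernel enclosures of `log 238, log 352, log 54723, log 58637,
log 10⁴`), the two tests `2⁸⁰(n+1) − plo`, `phi + 1 − 2⁸⁰n ≤ 2⁸⁰√n ℓ(ℓ − μ)/(8π)` after squaring in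
`ℕ` (`chkLNn_sound`: `√n ℓ(ℓ − μ) ≤ √n log n (log n − log log n)`, i.e. `≤ 2⁸⁰𝓑(n)`), whence
`x − ψ(x) < n + 1 − ψ(n) ≤ 𝓑(n) ≤ 𝓑(x)` and `ψ(x) − x ≤ ψ(n) − n ≤ 𝓑(n) ≤ 𝓑(x)` (`𝓑` is
non-decreasing on `[3, ∞)`, `bound_mono_three`). (Schoenfeld's chain compares with `√q`, `q` the last
prime power; at the cell `[222, 223)` that loses too much — `223 − ψ(211) = 1.01·𝓑(211)` — whence
`√n` and `log n` here; the tightest cell is then `[222, 223)` with `3 %` to spare.) The run: `350`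
integers from `PsiChain.initS` (`n = 2`) to `n = 352` (`run_all`, `decide +kernel`, standard axioms,
about a second).

## References

* E. S. Lee, P. Nosal, *Sharper bounds for the error in the prime number theorem assuming the Riemann
  Hypothesis*, J. Number Theory 283 (2026) 241–258, Thm. 1.2 and §3.3. [LeeNosal2026]
* J. Büthe, *An analytic method for bounding ψ(x)*, Math. Comp. 87 (2018), 1991–2009, Thm. 2. [Buthe2018]
* L. Schoenfeld, Math. Comp. 30 (1976), 337–360, Thm. 10 (the chain certifies his (6.2) in
  `SchoenfeldPsiTable`; here its Lee–Nosal variant). [Schoenfeld1976]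
-/

namespace Literature.NumberTheory.LFunctions.LeeNosalPsiChain

open PsiChain ChainCheck ChainTable ThetaChain

/-! ### The checker: the `ψ`-chain of `SchoenfeldPsiTable` with the Lee–Nosal comparison -/

/-- `MHI1 = ⌈2⁸⁰ · 1.6998⌉ ≥ 2⁸⁰ log log 238`. [cite: LeeNosal2026, Thm. 1.2 (finite-range certificate)] -/
def MHI1 : ℕ := 2054932108180946671165558

/-- `MHI2 = ⌈2⁸⁰ · 1.7689⌉ ≥ 2⁸⁰ log log 352`. [cite: LeeNosal2026, Thm. 1.2 (finite-range certificate)] -/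
def MHI2 : ℕ := 2138468882316317547137755

/-- The piecewise upper enclosure of `2⁸⁰ log log n` used on the cell `[n, n+1)`: `MHI1` below `239`,
`MHI2` from `239` on (valid for `n ≤ 352`). [cite: LeeNosal2026, Thm. 1.2 (finite-range certificate)] -/
def Mof (n : ℕ) : ℕ := bif Nat.blt n 239 then MHI1 else MHI2

/-- `chkLNn D n L M`: `L ≥ M + 2⁸⁰` and `D²·2¹⁶⁰·6316548210 ≤ n·L²·(L − M)²·10⁷`; since
`64π² < 631.654821`, it implies `D ≤ 2⁸⁰ √n ℓ(ℓ − μ)/(8π)` with `ℓ = L/2⁸⁰`, `μ = M/2⁸⁰`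
(`chkLNn_sound`). [cite: LeeNosal2026, Thm. 1.2 (finite-range certificate)] -/
def chkLNn (D n L M : ℕ) : Bool :=
  Nat.ble (Nat.add M SC) L &&
    Nat.ble (Nat.mul (Nat.mul (Nat.mul D D) P160) 6316548210)
      (Nat.mul (Nat.mul (Nat.mul n (Nat.mul L L)) (Nat.mul (Nat.sub L M) (Nat.sub L M))) 10000000)

/-- **The two comparisons on the cell `[n, n+1)`** (vacuous below `n₀`): with `(l, h) = logN n`
(`l ≤ 2⁸⁰ log n`), `2⁸⁰(n+1) − plo ≤ 2⁸⁰ √n ℓ(ℓ − μ)/(8π)` and `phi + 1 − 2⁸⁰ n ≤` the same,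
`μ = Mof n/2⁸⁰`. [cite: LeeNosal2026, Thm. 1.2 (finite-range certificate)] -/
def chkOK (n0 n : ℕ) (s : PS) : Bool :=
  match s with
  | ⟨_, _, _, _, _, plo, phi⟩ =>
    Nat.blt n n0 ||
      (match logN n with
       | none => false
       | some (l, _) =>
         chkLNn (Nat.sub (Nat.mul SC (Nat.add n 1)) plo) n l (Mof n) &&
           chkLNn (Nat.sub (Nat.add phi 1) (Nat.mul SC n)) n l (Mof n))

/-- **One step**, processing the integer `n`: `PsiChain.update`, then the two comparisons.
[cite: LeeNosal2026, Thm. 1.2 (finite-range certificate)] -/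
def step (n0 : ℕ) (s : PS) (n : ℕ) : Option PS :=
  match update s n with
  | none => none
  | some s' => bif chkOK n0 n s' then some s' else none

/-- **The run**: `fuel` consecutive integers starting with `n`.
[cite: LeeNosal2026, Thm. 1.2 (finite-range certificate)] -/
def run (n0 : ℕ) : ℕ → ℕ → PS → Option PS
  | 0, _, s => some s
  | fuel + 1, n, s =>
    match step n0 s n with
    | none => none
    | some s' => run n0 fuel (Nat.add n 1) s'


/-- **The kernel fact**: the run over `n = 3, …, 352` with the comparisons from `n₀ = 101` on
succeeds. [cite: LeeNosal2026, Thm. 1.2 (finite-range certificate)] -/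
theorem run_all : (run 101 350 3 initS).isSome = true := by
  decide +kernel

end Literature.NumberTheory.LFunctions.LeeNosalPsiChain

/-! ## Soundness -/

noncomputable section

namespace Literature.NumberTheory.LFunctions.LeeNosalPsiChain

open PsiChain ChainCheck ChainTable ThetaChain Real
open scoped Chebyshev

/-- `𝓑(x) = √x log x (log x − log log x)/(8π)` is non-decreasing on `[3, ∞)`.
[cite: LeeNosal2026, Thm. 1.2 (the bound `𝓑`)] -/
theorem bound_mono_three {x y : ℝ} (hx : 3 ≤ x) (hxy : x ≤ y) :
    LeeNosal2026.bound x ≤ LeeNosal2026.bound y := by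
  rw [LeeNosal2026.bound_def, LeeNosal2026.bound_def]
  have hπ := Real.pi_pos
  have hx0 : 0 < x := by linarith
  have he : Real.exp 1 ≤ x := le_trans Real.exp_one_lt_d9.le (by linarith)
  have hLx : 1 ≤ Real.log x := (Real.le_log_iff_exp_le hx0).2 he
  have hLxy : Real.log x ≤ Real.log y := Real.log_le_log hx0 hxy
  have h1 : Real.log (Real.log y) - Real.log (Real.log x) ≤ Real.log y - Real.log x := by
    rw [← Real.log_div (by linarith) (by linarith)]
    have h := Real.log_le_sub_one_of_pos (show 0 < Real.log y / Real.log x from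
      div_pos (by linarith) (by linarith))
    have h2 : Real.log y / Real.log x - 1 ≤ Real.log y - Real.log x := by
      rw [div_sub_one (by linarith), div_le_iff₀ (by linarith)]
      nlinarith
    linarith
  have h3 : 0 ≤ Real.log x - Real.log (Real.log x) := by
    have := Real.log_le_sub_one_of_pos (show 0 < Real.log x by linarith); linarith
  apply div_le_div_of_nonneg_right _ (by positivity)
  have h4 : Real.sqrt x * Real.log x ≤ Real.sqrt y * Real.log y :=
    mul_le_mul (Real.sqrt_le_sqrt hxy) hLxy (by linarith) (Real.sqrt_nonneg _)
  exact mul_le_mul h4 (by linarith) h3 (mul_nonneg (Real.sqrt_nonneg _) (by linarith))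

/-- `2⁸⁰ log log n ≤ Mof n` for `3 ≤ n ≤ 352` (`log 238 ≤ 5.4723`, `log 5.4723 ≤ 1.6998`;
`log 352 ≤ 5.8637`, `log 5.8637 ≤ 1.7689`; kernel enclosures). [folklore] -/
private theorem loglog_le_Mof {n : ℕ} (hn3 : 3 ≤ n) (hn : n ≤ 352) :
    2 ^ 80 * Real.log (Real.log n) ≤ (Mof n : ℝ) := by
  have e10 : Literature.Analysis.SpecialFunctions.KernelLog.logIv 10000 =
      some (11134618283120777461109716, 11134618283121253067415982) := by decide +kernel
  have hC := (Literature.Analysis.SpecialFunctions.KernelLog.logIv_sound e10).1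
  have hn3R : (3 : ℝ) ≤ n := by exact_mod_cast hn3
  have hlog0 : 0 < Real.log n := Real.log_pos (by linarith)
  simp only [Mof]
  cases hb : Nat.blt n 239 with
  | true =>
    simp only [cond_true]
    have h239 : n < 239 := by simpa [Nat.blt_eq] using hb
    have e1 : Literature.Analysis.SpecialFunctions.KernelLog.logIv 238 =
        some (6615569309321148687237195, 6615569309321624293301671) := by decide +kernel
    have e2 : Literature.Analysis.SpecialFunctions.KernelLog.logIv 54723 =
        some (13189428293878711793085009, 13189428293879187399536349) := by decide +kernel
    have hA := (Literature.Analysis.SpecialFunctions.KernelLog.logIv_sound e1).2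
    have hB := (Literature.Analysis.SpecialFunctions.KernelLog.logIv_sound e2).2
    simp only [Nat.cast_ofNat] at hA hB hC
    have hnR : (n : ℝ) ≤ 238 := by exact_mod_cast (by omega : n ≤ 238)
    have hlogn : Real.log n ≤ 54723 / 10000 := by
      have := Real.log_le_log (by linarith) hnR
      norm_num at hA ⊢
      linarith
    have hll : Real.log (Real.log n) ≤ Real.log 54723 - Real.log 10000 := by
      rw [← Real.log_div (by norm_num) (by norm_num)]
      exact Real.log_le_log hlog0 hlogn
    norm_num [MHI1] at hB hC ⊢
    linarith
  | false =>
    simp only [cond_false]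
    have e1 : Literature.Analysis.SpecialFunctions.KernelLog.logIv 352 =
        some (7088695124877584799675258, 7088695124878060405788092) := by decide +kernel
    have e2 : Literature.Analysis.SpecialFunctions.KernelLog.logIv 58637 =
        some (13272943065901217566060270, 13272943065901693172511610) := by decide +kernel
    have hA := (Literature.Analysis.SpecialFunctions.KernelLog.logIv_sound e1).2
    have hB := (Literature.Analysis.SpecialFunctions.KernelLog.logIv_sound e2).2
    simp only [Nat.cast_ofNat] at hA hB hC
    have hnR : (n : ℝ) ≤ 352 := by exact_mod_cast hn
    have hlogn : Real.log n ≤ 58637 / 10000 := by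
      have := Real.log_le_log (by linarith) hnR
      norm_num at hA ⊢
      linarith
    have hll : Real.log (Real.log n) ≤ Real.log 58637 - Real.log 10000 := by
      rw [← Real.log_div (by norm_num) (by norm_num)]
      exact Real.log_le_log hlog0 hlogn
    norm_num [MHI2] at hB hC ⊢
    linarith

/-- **Soundness of `chkLNn`**: if `chkLNn D n L M` holds, `L ≤ 2⁸⁰ log n`, `2⁸⁰ log log n ≤ M` and
`n ≥ 3`, then `D ≤ 2⁸⁰ 𝓑(n)`. [cite: LeeNosal2026, Thm. 1.2 (finite-range certificate)] -/
theorem chkLNn_sound {D n L M : ℕ} (h : chkLNn D n L M = true) (hn : 3 ≤ n)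
    (hL : (L : ℝ) ≤ 2 ^ 80 * Real.log n) (hM : 2 ^ 80 * Real.log (Real.log n) ≤ (M : ℝ)) :
    (D : ℝ) ≤ 2 ^ 80 * LeeNosal2026.bound n := by
  have hπ := Real.pi_pos
  simp only [chkLNn, Bool.and_eq_true, Nat.ble_eq, Nat.add_eq, Nat.mul_eq, Nat.sub_eq] at h
  obtain ⟨hMS, hble⟩ := h
  have hMle : M ≤ L := le_trans (Nat.le_add_right _ _) hMS
  have hR : (D : ℝ) * D * 2 ^ 160 * 6316548210 ≤
      (n : ℝ) * ((L : ℝ) * L) * (((L : ℝ) - M) * ((L : ℝ) - M)) * 10000000 := by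
    rw [P160_eq] at hble
    have := hble
    rw [← Nat.cast_sub hMle]
    exact_mod_cast this
  have hSC : ((M : ℝ) + 2 ^ 80) ≤ L := by
    rw [← SC_real]; exact_mod_cast hMS
  have hnR : (3 : ℝ) ≤ n := by exact_mod_cast hn
  have hlog1 : 1 ≤ Real.log n :=
    (Real.le_log_iff_exp_le (by linarith)).2 (le_trans Real.exp_one_lt_d9.le (by linarith))
  obtain ⟨μ, hμdef⟩ : ∃ μ : ℝ, μ = (M : ℝ) := ⟨_, rfl⟩
  rw [← hμdef] at hR hSC hM
  have hℓM0 : (0 : ℝ) ≤ (L : ℝ) - μ := by linarith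
  have hL0 : (0 : ℝ) ≤ L := Nat.cast_nonneg _
  have h2_80 : (0 : ℝ) ≤ 2 ^ 80 := pow_nonneg zero_le_two 80
  have ha : (0 : ℝ) ≤ (D : ℝ) * 2 ^ 80 * (8 * Real.pi) :=
    mul_nonneg (mul_nonneg (Nat.cast_nonneg _) h2_80) (by linarith)
  have hb : (0 : ℝ) ≤ Real.sqrt n * ((L : ℝ) * ((L : ℝ) - μ)) :=
    mul_nonneg (Real.sqrt_nonneg _) (mul_nonneg hL0 hℓM0)
  have h1 : ((D : ℝ) * 2 ^ 80 * (8 * Real.pi)) ^ 2 ≤ (n : ℝ) * ((L : ℝ) * ((L : ℝ) - μ)) ^ 2 := by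
    have e : ((D : ℝ) * 2 ^ 80 * (8 * Real.pi)) ^ 2 =
        (D : ℝ) * D * 2 ^ 160 * (64 * Real.pi ^ 2 * 10000000) / 10000000 := by ring
    rw [e, div_le_iff₀ (by norm_num)]
    have e' : (n : ℝ) * ((L : ℝ) * L) * (((L : ℝ) - μ) * ((L : ℝ) - μ)) * 10000000 =
        (n : ℝ) * ((L : ℝ) * ((L : ℝ) - μ)) ^ 2 * 10000000 := by ring
    calc (D : ℝ) * D * 2 ^ 160 * (64 * Real.pi ^ 2 * 10000000)
        ≤ (D : ℝ) * D * 2 ^ 160 * 6316548210 := by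
          apply mul_le_mul_of_nonneg_left pi_sq_bound
          exact mul_nonneg (mul_nonneg (Nat.cast_nonneg _) (Nat.cast_nonneg _))
            (pow_nonneg zero_le_two 160)
      _ ≤ (n : ℝ) * ((L : ℝ) * L) * (((L : ℝ) - μ) * ((L : ℝ) - μ)) * 10000000 := hR
      _ = (n : ℝ) * ((L : ℝ) * ((L : ℝ) - μ)) ^ 2 * 10000000 := e'
  have e2 : (Real.sqrt n * ((L : ℝ) * ((L : ℝ) - μ))) ^ 2 = (n : ℝ) * ((L : ℝ) * ((L : ℝ) - μ)) ^ 2 := by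
    rw [mul_pow, Real.sq_sqrt (Nat.cast_nonneg _)]
  have h3 : ((D : ℝ) * 2 ^ 80 * (8 * Real.pi)) ^ 2 ≤ (Real.sqrt n * ((L : ℝ) * ((L : ℝ) - μ))) ^ 2 := by
    rw [e2]; exact h1
  have h4 : (D : ℝ) * 2 ^ 80 * (8 * Real.pi) ≤ Real.sqrt n * ((L : ℝ) * ((L : ℝ) - μ)) :=
    (pow_le_pow_iff_left₀ ha hb two_ne_zero).1 h3
  have h5 : (L : ℝ) * ((L : ℝ) - μ) ≤
      (2 ^ 80 * Real.log n) * (2 ^ 80 * (Real.log n - Real.log (Real.log n))) := by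
    apply mul_le_mul hL _ hℓM0 (mul_nonneg h2_80 (by linarith))
    linarith
  have h6 : (D : ℝ) * 2 ^ 80 * (8 * Real.pi) ≤
      Real.sqrt n * ((2 ^ 80 * Real.log n) * (2 ^ 80 * (Real.log n - Real.log (Real.log n)))) :=
    h4.trans (mul_le_mul_of_nonneg_left h5 (Real.sqrt_nonneg _))
  rw [LeeNosal2026.bound_def]
  have h7 : (D : ℝ) ≤ Real.sqrt n * ((2 ^ 80 * Real.log n) *
      (2 ^ 80 * (Real.log n - Real.log (Real.log n)))) / (2 ^ 80 * (8 * Real.pi)) := by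
    rw [le_div_iff₀ (mul_pos (pow_pos two_pos 80) (by linarith))]
    linarith [h6]
  have e8 : Real.sqrt n * ((2 ^ 80 * Real.log n) *
      (2 ^ 80 * (Real.log n - Real.log (Real.log n)))) / (2 ^ 80 * (8 * Real.pi)) =
      2 ^ 80 * (Real.sqrt n * Real.log n * (Real.log n - Real.log (Real.log n)) / (8 * Real.pi)) := by
    field_simp
  linarith [h7, e8]

/-- **Soundness of the two comparisons**: if `chkOK n₀ n t` passes, `n₀ ≤ n`, `3 ≤ n ≤ 352`, and
`plo ≤ 2⁸⁰ψ(n) ≤ phi`, the Lee–Nosal bound holds on `[n, n+1)` (`ψ(x) = ψ(n)` there;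
`x − ψ(n) < n + 1 − ψ(n) ≤ 𝓑(n) ≤ 𝓑(x)` and `ψ(n) − x ≤ ψ(n) − n < 𝓑(n) ≤ 𝓑(x)`).
[cite: LeeNosal2026, Thm. 1.2 (finite-range certificate)] -/
theorem chkOK_sound {n0 n : ℕ} {t : PS} (h : chkOK n0 n t = true)
    (hlo : (t.plo : ℝ) ≤ 2 ^ 80 * ψ (n : ℝ)) (hhi : 2 ^ 80 * ψ (n : ℝ) ≤ t.phi) (hn0 : n0 ≤ n)
    (hn3 : 3 ≤ n) (hn : n ≤ 352) {x : ℝ} (hx1 : (n : ℝ) ≤ x) (hx2 : x < n + 1) :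
    |ψ x - x| ≤ LeeNosal2026.bound x := by
  obtain ⟨pr, Lplo, Lphi, q, Lq, plo, phi⟩ := t
  simp only at hlo hhi
  have h' : (Nat.blt n n0 ||
      (match logN n with
       | none => false
       | some (l, _) =>
         chkLNn (Nat.sub (Nat.mul SC (Nat.add n 1)) plo) n l (Mof n) &&
           chkLNn (Nat.sub (Nat.add phi 1) (Nat.mul SC n)) n l (Mof n))) = true := h
  rw [Bool.or_eq_true] at h'
  rcases h' with hlt | hc
  · rw [Nat.blt_eq] at hlt
    omega
  · rcases hl : logN n with _ | ⟨l, lh⟩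
    · rw [hl] at hc; exact absurd hc (by simp)
    · rw [hl] at hc
      simp only [Bool.and_eq_true, Nat.sub_eq, Nat.mul_eq, Nat.add_eq] at hc
      obtain ⟨hc1, hc2⟩ := hc
      obtain ⟨hl1, -, -⟩ := logN_sound hl
      have hM := loglog_le_Mof hn3 hn
      have hL := chkLNn_sound hc1 hn3 hl1 hM
      have hU := chkLNn_sound hc2 hn3 hl1 hM
      have h1 := real_sub_le_natSub (SC * (n + 1)) plo
      have h2 := real_sub_le_natSub (phi + 1) (SC * n)
      push_cast at h1 h2
      rw [SC_real] at h1 h2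
      have hn3R : (3 : ℝ) ≤ n := by exact_mod_cast hn3
      have hBB : LeeNosal2026.bound n ≤ LeeNosal2026.bound x := bound_mono_three hn3R hx1
      have hψ : ψ x = ψ (n : ℝ) := psi_eq_psi_nat hx1 hx2
      have h80 : (0 : ℝ) < 2 ^ 80 := pow_pos two_pos 80
      rw [hψ, abs_sub_le_iff]
      constructor
      · have h3 : 2 ^ 80 * (ψ (n : ℝ) - n) ≤ 2 ^ 80 * LeeNosal2026.bound n := by linarith
        have h4 : ψ (n : ℝ) - n ≤ LeeNosal2026.bound n := le_of_mul_le_mul_left h3 h80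
        linarith
      · have h3 : 2 ^ 80 * ((n : ℝ) + 1 - ψ (n : ℝ)) ≤ 2 ^ 80 * LeeNosal2026.bound n := by linarith
        have h4 : (n : ℝ) + 1 - ψ (n : ℝ) ≤ LeeNosal2026.bound n := le_of_mul_le_mul_left h3 h80
        linarith

/-- **The invariant** of the run at the integer `n` (comparisons from `n₀`): the bookkeeping of
`PsiChain.Inv` and the Lee–Nosal bound on `[n₀, n+1)`. [cite: LeeNosal2026, Thm. 1.2 (finite-range certificate)] -/
def Inv (n0 n : ℕ) (s : PS) : Prop :=
  (0 < s.pr ∧ s.pr ≤ n ∧ (s.Lplo : ℝ) ≤ 2 ^ 80 * Real.log s.pr ∧ 2 ^ 80 * Real.log s.pr ≤ s.Lphi) ∧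
  (1 ≤ s.q ∧ s.q ≤ n ∧ (s.Lq : ℝ) ≤ 2 ^ 80 * Real.log s.q) ∧
  ((s.plo : ℝ) ≤ 2 ^ 80 * ψ (n : ℝ) ∧ 2 ^ 80 * ψ (n : ℝ) ≤ s.phi) ∧
  ∀ x : ℝ, (n0 : ℝ) ≤ x → x < n + 1 → |ψ x - x| ≤ LeeNosal2026.bound x

/-- **Soundness of one step** (`3 ≤ n0`, `n + 1 ≤ 352`). [cite: LeeNosal2026, Thm. 1.2 (finite-range certificate)] -/
theorem step_sound {n0 n : ℕ} {s s' : PS} (hI : Inv n0 n s) (h : step n0 s (n + 1) = some s')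
    (h3 : 3 ≤ n0) (hn : n + 1 ≤ 352) : Inv n0 (n + 1) s' := by
  obtain ⟨pr, Lplo, Lphi, q, Lq, plo, phi⟩ := s
  obtain ⟨⟨hpr0, hprn, hLplo, hLphi⟩, ⟨hq1, hqn, hLq⟩, ⟨hlo, hhi⟩, hcov⟩ := hI
  simp only at hpr0 hprn hLplo hLphi hq1 hqn hLq hlo hhi
  simp only [step] at h
  rcases hu : update ⟨pr, Lplo, Lphi, q, Lq, plo, phi⟩ (n + 1) with _ | t
  · rw [hu] at h; exact absurd h (by simp)
  · rw [hu] at h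
    simp only at h
    obtain ⟨hok, rfl⟩ := bif_some h
    obtain ⟨⟨h1, h2, h3', h4⟩, ⟨h5, h6, h7⟩, ⟨h8, h9⟩⟩ :=
      update_sound hu (by omega) hpr0 hprn hLplo hLphi hq1 hqn hLq hlo hhi
    refine ⟨⟨h1, h2, h3', h4⟩, ⟨h5, h6, h7⟩, ⟨h8, h9⟩, fun x hx0 hx2 => ?_⟩
    rcases lt_or_ge x ((n : ℝ) + 1) with hx1 | hx1
    · exact hcov x hx0 hx1
    · have hx1' : ((n + 1 : ℕ) : ℝ) ≤ x := by push_cast; exact hx1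
      have hn0 : n0 ≤ n + 1 := by
        by_contra hh
        have : ((n + 1 : ℕ) : ℝ) + 1 ≤ n0 := by exact_mod_cast (by omega : n + 1 + 1 ≤ n0)
        linarith
      exact chkOK_sound hok h8 h9 hn0 (by omega) hn hx1' hx2

/-- **Soundness of the run** (`n + fuel ≤ 352`). [cite: LeeNosal2026, Thm. 1.2 (finite-range certificate)] -/
theorem run_sound {n0 : ℕ} (h3 : 3 ≤ n0) : ∀ (fuel n : ℕ) (s s' : PS), Inv n0 n s →
    run n0 fuel (n + 1) s = some s' → n + fuel ≤ 352 → Inv n0 (n + fuel) s'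
  | 0, n, s, s', hI, h, _ => by
      simp only [run, Option.some.injEq] at h
      subst h
      simpa using hI
  | fuel + 1, n, s, s', hI, h, hn => by
      simp only [run, Nat.add_eq] at h
      rcases hst : step n0 s (n + 1) with _ | s₁
      · rw [hst] at h; exact absurd h (by simp)
      · rw [hst] at h
        simp only at h
        have hI1 := step_sound hI hst h3 (by omega)
        have := run_sound h3 fuel (n + 1) s₁ s' hI1 h (by omega)
        rwa [show n + 1 + fuel = n + (fuel + 1) by omega] at this

/-- The invariant holds initially (`n = 2`, `n₀ = 101`). [cite: LeeNosal2026, Thm. 1.2 (finite-range certificate)] -/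
theorem initS_inv : Inv 101 2 initS := by
  have h1 := L2LON_le
  have h2 := le_L2HIN
  have hψ2 : ψ ((2 : ℕ) : ℝ) = Real.log 2 := psi_two
  refine ⟨⟨by norm_num [PsiChain.initS], le_rfl, ?_, ?_⟩, ⟨by norm_num [PsiChain.initS], le_rfl, ?_⟩,
    ⟨?_, ?_⟩, ?_⟩
  · simpa [PsiChain.initS] using h1
  · simpa [PsiChain.initS] using h2
  · simpa [PsiChain.initS] using h1
  · rw [hψ2]; simpa [PsiChain.initS] using h1
  · rw [hψ2]; simpa [PsiChain.initS] using h2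
  · intro x hx1 hx2
    norm_num at hx1 hx2
    linarith

/-! ### The window `101 ≤ x < 353`, and Theorem 1.2 (`ψ`) for all `x ≥ 101` modulo Büthe -/

/-- **Lee–Nosal's `ψ`-inequality on `101 ≤ x < 353`, unconditionally, by kernel computation**:
`|ψ(x) − x| ≤ √x log x (log x − log log x)/(8π)`. [cite: LeeNosal2026, Thm. 1.2] -/
theorem abs_psi_sub_le_window {x : ℝ} (h1 : 101 ≤ x) (h2 : x < 353) :
    |ψ x - x| ≤ LeeNosal2026.bound x := by
  obtain ⟨s', hs'⟩ := Option.isSome_iff_exists.1 run_all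
  have hI := run_sound (n0 := 101) (by norm_num) 350 2 initS s' initS_inv hs' (by norm_num)
  exact hI.2.2.2 x (by exact_mod_cast h1) (by norm_num; exact h2)

/-- **Lee–Nosal 2026, Theorem 1.2 (`ψ`) on its full printed range `x ≥ 101` — PROVED under RH
modulo Büthe's Theorem 2** (`Buthe2018_thm2_psi`): the window `[101, 353)` by the kernel run above,
`[350, 10¹⁹]` by Büthe, beyond by the explicit formula (`LeeNosalThm12.psi_of_buthe`).
[cite: LeeNosal2026, Thm. 1.2; Buthe2018, Thm. 2] -/
theorem LeeNosal2026_psi_of_buthe (hB : Buthe2018_thm2_psi) (hRH : RiemannHypothesis) {x : ℝ}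
    (hx : 101 ≤ x) : |ψ x - x| ≤ LeeNosal2026.bound x := by
  rcases lt_or_ge x 353 with h | h
  · exact abs_psi_sub_le_window hx h
  · exact LeeNosalThm12.psi_of_buthe hB hRH (by linarith)

end Literature.NumberTheory.LFunctions.LeeNosalPsiChain

namespace Literature.NumberTheory.LFunctions

open scoped Chebyshev

/-- **Lee–Nosal 2026, Theorem 1.2 — the named fact `LeeNosal2026_thm12` PROVED modulo Büthe's
Theorem 2**: under RH, `|ψ(x) − x| ≤ √x log x (log x − log log x)/(8π)` for `x ≥ 101` and
`|θ(x) − x| ≤` the same for `x ≥ 2657`, given Büthe's unconditional `|x − ψ(x)| ≤ 0.94√x`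
(`11 < x ≤ 10¹⁹`) and `0.05√x < x − θ(x) ≤ 1.95√x` (`1423 ≤ x ≤ 10¹⁹`). The windows `[101, 353)` and
`[2657, 3511]` are kernel computations, `[350, 10¹⁹]`/`[3500, 10¹⁹]` are Büthe's, and `x ≥ 10¹⁰`/`10¹⁴`
is the explicit formula under RH (`PrimeNumberTheoremErrorRHExplicitProofs.lean`).
[cite: LeeNosal2026, Thm. 1.2; Buthe2018, Thm. 2] -/
theorem LeeNosal2026_thm12_of_buthe (hψ : Buthe2018_thm2_psi) (hθ : Buthe2018_thm2_theta) :
    LeeNosal2026_thm12 := fun hRH =>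
  ⟨fun _ hx => LeeNosalPsiChain.LeeNosal2026_psi_of_buthe hψ hRH hx,
    fun _ hx => LeeNosalThetaChain.LeeNosal2026_theta_of_buthe hθ hRH hx⟩

end Literature.NumberTheory.LFunctions

end
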